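import Literature.NumberTheory.Sieve.CFSemigroupPressure
import HarnessLib

/-!
# Sections of the word tree of `Γ_A` and their size

Support file (all results proved) for the named fact
`Literature.NumberTheory.Sieve.MageeOhWinter2019_uniformCounting` (`CFSemigroupCounting.lean`):
the renewal-type ("stopping time") decomposition behind lattice-point counts for the continued
fractions semigroup ([MageeOhWinter2019, §3]: the count is organised along the tree of words; here
in the elementary form of Lalley's sections / Hensley's counting of continuants).

For a threshold `X` the **section** `S_X` is the set of finite words `w ∈ A^*` whose continuant
first exceeds `X` at the last letter: `q(w) > X ≥ q(w')` for every proper prefix `w'`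
(`cfStop`). Every long word has exactly one prefix in `S_X` (`exists_cfStop`, `cfStop_unique`), so
`Aᴺ` is tiled by the fibres `{w u}` over `w ∈ S_X` (`cfIns`), and the Gibbs bounds
`1 ≤ Z_n(s) ≤ 4^s` of the partition functions `Z_n(s) = Σ_{w ∈ Aⁿ} q(w)^{-2s}`
(`CFSemigroupPressure.lean`; they hold at `s = δ_A`) transfer to the section:

* `card_cfSec_le`: `#S_X ≤ 16^s ((B+1) X)^{2s}` (`X ≥ 1`, `A ⊆ [1, B]`);
* `le_card_cfSec`: `4^{-s} X^{2s} ≤ #S_X` (`X ≥ 1`),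

whenever `1 ≤ Z_n(s) ≤ 4^s` for all `n`. These are the two halves of Hensley's estimate
`#{w : q(w) ≤ X} ≍ X^{2δ_A}` (sequel file).

## References

* M. Magee, H. Oh, D. Winter, J. reine angew. Math. 753 (2019) 89–135, §3 (renewal along the
  word tree). [MageeOhWinter2019]
* S. P. Lalley, *Renewal theorems in symbolic dynamics…*, Acta Math. 163 (1989) 1–55, §1–2.
* D. Hensley, *The distribution of badly approximable rationals and continuants with bounded
  digits. II*, J. Number Theory 34 (1990) 293–334, §2.
-/

noncomputable section

open Filter Set
open scoped Classical

namespace Literature.NumberTheory.Sieve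

variable {A : Finset ℕ} {N n m : ℕ}

/-! ### Prefix continuants of a word -/

/-- The digit sequence of a word `v ∈ Aᴺ` (extended by `1`). [folklore] -/
def cfDig (v : Fin N → A) : ℕ → ℕ := cfExt fun i => (v i : ℕ)

/-- The prefix continuants `q_k(v)`, `k ≤ N`, of a word `v ∈ Aᴺ`. [folklore] -/
def cfQk (v : Fin N → A) (k : ℕ) : ℤ := cfDen (cfDig v) k

/-- `q_N(v) = q(v)`. [folklore] -/
theorem cfQk_self (v : Fin N → A) : cfQk v N = cfQ fun i => (v i : ℕ) := rfl

/-- `q_0(v) = 1`. [folklore] -/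
@[simp] theorem cfQk_zero (v : Fin N → A) : cfQk v 0 = 1 := by simp [cfQk]

/-- Digits of a word over `A ⊆ ℕ_{≥1}` are `≥ 1`. [folklore] -/
theorem one_le_cfDig (hA : ∀ a ∈ A, 1 ≤ a) (v : Fin N → A) (i : ℕ) : 1 ≤ cfDig v i :=
  one_le_cfExt (one_le_coe_digit hA v) i

/-- Digits of a word over `A ⊆ [1, B]` are `≤ B`. [folklore] -/
theorem cfDig_le (hA : ∀ a ∈ A, 1 ≤ a) {B : ℕ} (hB : ∀ a ∈ A, a ≤ B) (hne : A.Nonempty)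
    (v : Fin N → A) (i : ℕ) : cfDig v i ≤ B := by
  obtain ⟨a, ha⟩ := hne
  exact cfExt_le ((hA a ha).trans (hB a ha)) (fun i => hB _ (v i).2) i

/-- The digit below the length is the letter. [folklore] -/
theorem cfDig_of_lt (v : Fin N → A) {i : ℕ} (hi : i < N) : cfDig v i = (v ⟨i, hi⟩ : ℕ) :=
  cfExt_of_lt _ hi

/-- Prefix continuants are `≥ 1`. [folklore] -/
theorem one_le_cfQk (hA : ∀ a ∈ A, 1 ≤ a) (v : Fin N → A) (k : ℕ) : 1 ≤ cfQk v k :=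
  one_le_cfDen (one_le_cfDig hA v) k

/-- Prefix continuants are monotone in `k`. [folklore] -/
theorem cfQk_mono (hA : ∀ a ∈ A, 1 ≤ a) (v : Fin N → A) : Monotone (cfQk v) :=
  monotone_nat_of_le_succ (cfDen_le_succ (one_le_cfDig hA v))

/-- `q_{k+1}(v) ≤ (B+1) q_k(v)`. [folklore] -/
theorem cfQk_succ_le (hA : ∀ a ∈ A, 1 ≤ a) {B : ℕ} (hB : ∀ a ∈ A, a ≤ B) (hne : A.Nonempty)
    (v : Fin N → A) (k : ℕ) : cfQk v (k + 1) ≤ (B + 1) * cfQk v k :=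
  cfDen_succ_le (one_le_cfDig hA v) (cfDig_le hA hB hne v) k

/-- `2^{N-1} ≤ q(v)²`. [folklore] -/
theorem pow_le_cfQk_sq (hA : ∀ a ∈ A, 1 ≤ a) (v : Fin N → A) : (2 : ℤ) ^ (N - 1) ≤ cfQk v N ^ 2 :=
  pow_le_cfQ_sq (one_le_coe_digit hA v)

/-- Words with the same digits below `n` have the same prefix continuants up to `n`. [folklore] -/
theorem cfQk_eq_of_agree {N' : ℕ} {v : Fin N → A} {v' : Fin N' → A} {n : ℕ}
    (h : ∀ i < n, cfDig v i = cfDig v' i) {k : ℕ} (hk : k ≤ n) : cfQk v k = cfQk v' k := by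
  simp only [cfQk, cfDen]
  rw [cfWord_congr fun i hi => h i (lt_of_lt_of_le hi hk)]

/-! ### Stopping: the section `S_X` -/

/-- `cfStop X v n`: the prefix continuants of `v` first exceed `X` at place `n`
(`q_n(v) > X ≥ q_k(v)` for `k < n`), i.e. the length-`n` prefix of `v` belongs to the section
`S_X`. [folklore] -/
def cfStop (X : ℝ) (v : Fin N → A) (n : ℕ) : Prop :=
  X < (cfQk v n : ℝ) ∧ ∀ k < n, (cfQk v k : ℝ) ≤ X

/-- The stopping place is unique. [folklore] -/
theorem cfStop_unique {X : ℝ} {v : Fin N → A} {n n' : ℕ} (h : cfStop X v n) (h' : cfStop X v n') :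
    n = n' := by
  by_contra hne
  rcases lt_or_gt_of_ne hne with hlt | hlt
  · exact absurd (h'.2 n hlt) (not_le.2 h.1)
  · exact absurd (h.2 n' hlt) (not_le.2 h'.1)

/-- Stopping depends only on the digits below the stopping place. [folklore] -/
theorem cfStop_iff_of_agree {N' : ℕ} {X : ℝ} {v : Fin N → A} {v' : Fin N' → A} {n : ℕ}
    (h : ∀ i < n, cfDig v i = cfDig v' i) : cfStop X v n ↔ cfStop X v' n := by
  simp only [cfStop, cfQk_eq_of_agree h le_rfl]
  constructor
  · rintro ⟨h1, h2⟩
    exact ⟨h1, fun k hk => by rw [← cfQk_eq_of_agree h hk.le]; exact h2 k hk⟩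
  · rintro ⟨h1, h2⟩
    exact ⟨h1, fun k hk => by rw [cfQk_eq_of_agree h hk.le]; exact h2 k hk⟩

/-- A word whose full continuant exceeds `X` stops somewhere `≤ N`. [folklore] -/
theorem exists_cfStop {X : ℝ} {v : Fin N → A} (hX : X < (cfQk v N : ℝ)) :
    ∃ n, n ≤ N ∧ cfStop X v n := by
  have hex : ∃ n, X < (cfQk v n : ℝ) := ⟨N, hX⟩
  refine ⟨Nat.find hex, Nat.find_min' hex hX, Nat.find_spec hex, fun k hk => ?_⟩
  exact not_lt.1 (Nat.find_min hex hk)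

/-- Long words stop: if `2^{N-1} > X²` (and `X ≥ 0`) every `v ∈ Aᴺ` stops at some `n ≤ N`.
[folklore] -/
theorem exists_cfStop_of_pow (hA : ∀ a ∈ A, 1 ≤ a) {X : ℝ} (hX0 : 0 ≤ X)
    (hN : X ^ 2 < (2 : ℝ) ^ (N - 1)) (v : Fin N → A) : ∃ n, n ≤ N ∧ cfStop X v n := by
  refine exists_cfStop ?_
  have h1 : ((2 : ℤ) ^ (N - 1) : ℝ) ≤ ((cfQk v N : ℤ) : ℝ) ^ 2 := by
    exact_mod_cast pow_le_cfQk_sq hA v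
  push_cast at h1
  have hq : (0 : ℝ) ≤ (cfQk v N : ℝ) := by
    exact_mod_cast (zero_le_one.trans (one_le_cfQk hA v N))
  nlinarith

/-- For `X ≥ 1` nobody stops at place `0`. [folklore] -/
theorem cfStop_pos {X : ℝ} (hX : 1 ≤ X) {v : Fin N → A} {n : ℕ} (h : cfStop X v n) : 0 < n := by
  rcases Nat.eq_zero_or_pos n with rfl | hn
  · have := h.1
    simp at this
    linarith
  · exact hn

/-- At a stopping place `n ≥ 1`: `q_n(v) ≤ (B+1) X`. [folklore] -/
theorem cfQk_le_of_cfStop (hA : ∀ a ∈ A, 1 ≤ a) {B : ℕ} (hB : ∀ a ∈ A, a ≤ B) (hne : A.Nonempty)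
    {X : ℝ} (hX : 1 ≤ X) {v : Fin N → A} {n : ℕ} (h : cfStop X v n) :
    (cfQk v n : ℝ) ≤ ((B : ℝ) + 1) * X := by
  obtain ⟨k, rfl⟩ := Nat.exists_eq_succ_of_ne_zero (cfStop_pos hX h).ne'
  have h1 : (cfQk v (k + 1) : ℝ) ≤ ((B : ℝ) + 1) * cfQk v k := by
    exact_mod_cast cfQk_succ_le hA hB hne v k
  have h2 := h.2 k (Nat.lt_succ_self k)
  have hB0 : (0 : ℝ) ≤ (B : ℝ) + 1 := by positivity
  nlinarith

/-! ### Fibres: inserting a tail after a prefix -/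

/-- `cfIns N w u ∈ Aᴺ`: the word with prefix `w ∈ Aⁿ` followed by `u ∈ A^{N-n}` (`n ≤ N`).
[folklore] -/
def cfIns (N : ℕ) (w : Fin n → A) (u : Fin (N - n) → A) : Fin N → A :=
  fun i => if h : (i : ℕ) < n then w ⟨i, h⟩ else u ⟨i - n, by omega⟩

/-- The digits of `cfIns N w u` below `n` are those of `w`. [folklore] -/
theorem cfDig_cfIns_of_lt (hn : n ≤ N) (w : Fin n → A) (u : Fin (N - n) → A) {i : ℕ} (hi : i < n) :
    cfDig (cfIns N w u) i = cfDig w i := by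
  rw [cfDig_of_lt _ (lt_of_lt_of_le hi hn), cfDig_of_lt _ hi]
  simp [cfIns, hi]

/-- The digits of `cfIns N w u` from place `n` on are those of `u`. [folklore] -/
theorem cfDig_cfIns_add (w : Fin n → A) (u : Fin (N - n) → A) {i : ℕ} (hi : i < N - n) :
    cfDig (cfIns N w u) (i + n) = cfDig u i := by
  rw [cfDig_of_lt _ (by omega), cfDig_of_lt _ hi]
  have h : ¬ (i + n < n) := by omega
  simp only [cfIns, h, dif_neg, not_false_eq_true]
  congr 2
  exact Fin.ext (Nat.add_sub_cancel i n)

/-- The word matrix of `cfIns N w u` is `M_w M_u`. [folklore] -/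
theorem cfWord_cfDig_cfIns (hn : n ≤ N) (w : Fin n → A) (u : Fin (N - n) → A) :
    cfWord (cfDig (cfIns N w u)) N = cfMat (fun i => (w i : ℕ)) * cfMat fun i => (u i : ℕ) := by
  have hsplit := cfWord_add (cfDig (cfIns N w u)) n (N - n)
  rw [Nat.sub_add_cancel hn] at hsplit
  rw [hsplit]
  unfold cfMat
  congr 1
  · exact cfWord_congr fun i hi => cfDig_cfIns_of_lt hn w u hi
  · exact cfWord_congr fun i hi => cfDig_cfIns_add w u hi

/-- The continuant of `cfIns N w u` is the continuant of the concatenation `w u`. [folklore] -/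
theorem cfQk_cfIns (hn : n ≤ N) (w : Fin n → A) (u : Fin (N - n) → A) :
    cfQk (cfIns N w u) N = cfQ (Fin.append (fun i => (w i : ℕ)) fun i => (u i : ℕ)) := by
  rw [cfQ_eq, cfMat_append]
  show cfWord (cfDig (cfIns N w u)) N 1 1 = _
  rw [cfWord_cfDig_cfIns hn]

/-- **Quasi-multiplicativity on fibres:** `q(w) q(u) ≤ q(w u) ≤ 2 q(w) q(u)`. [folklore] -/
theorem cfQk_cfIns_bounds (hA : ∀ a ∈ A, 1 ≤ a) (hn : n ≤ N) (w : Fin n → A) (u : Fin (N - n) → A) :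
    cfQk w n * cfQk u (N - n) ≤ cfQk (cfIns N w u) N ∧
      cfQk (cfIns N w u) N ≤ 2 * (cfQk w n * cfQk u (N - n)) := by
  rw [cfQk_cfIns hn, cfQk_self, cfQk_self]
  exact ⟨cfQ_mul_le_cfQ_append (one_le_coe_digit hA u),
    cfQ_append_le (one_le_coe_digit hA w) (one_le_coe_digit hA u)⟩

/-- `u ↦ cfIns N w u` is injective. [folklore] -/
theorem cfIns_injective (w : Fin n → A) : Function.Injective (cfIns N w) := by
  intro u u' h
  funext i
  have hi : (i : ℕ) + n < N := by omega
  have := congrFun h ⟨i + n, hi⟩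
  have hlt : ¬ ((i : ℕ) + n < n) := by omega
  simp only [cfIns, hlt, dif_neg, not_false_eq_true] at this
  have e : (⟨(i : ℕ) + n - n, by omega⟩ : Fin (N - n)) = i := Fin.ext (Nat.add_sub_cancel _ _)
  rwa [e] at this

/-- Stopping transfers to the fibre: `cfIns N w u` stops at `k ≤ n` iff `w` does. [folklore] -/
theorem cfStop_cfIns_iff (hn : n ≤ N) {X : ℝ} (w : Fin n → A) (u : Fin (N - n) → A) {k : ℕ}
    (hk : k ≤ n) : cfStop X (cfIns N w u) k ↔ cfStop X w k :=
  cfStop_iff_of_agree fun _ hi => cfDig_cfIns_of_lt hn w u (lt_of_lt_of_le hi hk)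

/-- The prefix of length `n ≤ N` of a word. [folklore] -/
def cfRestr (hn : n ≤ N) (v : Fin N → A) : Fin n → A := fun i => v ⟨i, lt_of_lt_of_le i.2 hn⟩

/-- The tail after place `n` of a word. [folklore] -/
def cfTail (n : ℕ) (v : Fin N → A) : Fin (N - n) → A := fun i => v ⟨i + n, by omega⟩

/-- Every word is its prefix followed by its tail. [folklore] -/
theorem cfIns_cfRestr_cfTail (hn : n ≤ N) (v : Fin N → A) :
    cfIns N (cfRestr hn v) (cfTail n v) = v := by
  funext i
  simp only [cfIns, cfRestr, cfTail]
  split_ifs with h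
  · rfl
  · congr 1
    exact Fin.ext (by simp only; omega)

/-- The prefix has the word's digits below `n`. [folklore] -/
theorem cfDig_cfRestr (hn : n ≤ N) (v : Fin N → A) {i : ℕ} (hi : i < n) :
    cfDig (cfRestr hn v) i = cfDig v i := by
  rw [cfDig_of_lt _ hi, cfDig_of_lt _ (lt_of_lt_of_le hi hn)]
  rfl

/-! ### The section as a finite set, and its size -/

variable (A) in
/-- The section `S_X` truncated at length `N`: pairs `(n, w)` with `n ≤ N`, `w ∈ Aⁿ` stopping at
its own length. [folklore] -/
def cfSec (X : ℝ) (N : ℕ) : Finset (Σ n : ℕ, Fin n → A) :=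
  (Finset.range (N + 1)).sigma fun n => Finset.univ.filter fun w : Fin n → A => cfStop X w n

/-- Membership in the truncated section. [folklore] -/
theorem mem_cfSec {X : ℝ} {x : Σ n : ℕ, Fin n → A} :
    x ∈ cfSec A X N ↔ x.1 ≤ N ∧ cfStop X x.2 x.1 := by
  simp [cfSec]

/-- The fibres over distinct section elements are disjoint (uniqueness of stopping). [folklore] -/
theorem cfSec_pairwiseDisjoint (X : ℝ) (N : ℕ) :
    Set.PairwiseDisjoint (↑(cfSec A X N) : Set (Σ n : ℕ, Fin n → A))
      fun x => (Finset.univ : Finset (Fin (N - x.1) → A)).image (cfIns N x.2) := by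
  intro x hx y hy hxy
  rw [Function.onFun, Finset.disjoint_left]
  intro v hvx hvy
  apply hxy
  rw [Finset.mem_coe, mem_cfSec] at hx hy
  obtain ⟨u, -, rfl⟩ := Finset.mem_image.1 hvx
  obtain ⟨u', -, hu'⟩ := Finset.mem_image.1 hvy
  have h1 : cfStop X (cfIns N x.2 u) x.1 := (cfStop_cfIns_iff hx.1 x.2 u le_rfl).2 hx.2
  have h2 : cfStop X (cfIns N x.2 u) y.1 := by
    rw [← hu']
    exact (cfStop_cfIns_iff hy.1 y.2 u' le_rfl).2 hy.2
  have heq : x.1 = y.1 := cfStop_unique h1 h2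
  obtain ⟨n, w⟩ := x
  obtain ⟨n', w'⟩ := y
  simp only at heq
  subst heq
  have hww : w = w' := by
    funext i
    apply Subtype.ext
    have e1 := cfDig_cfIns_of_lt hx.1 w u i.2
    have e2 := cfDig_cfIns_of_lt hy.1 w' u' i.2
    rw [hu'] at e2
    rw [e1] at e2
    rw [cfDig_of_lt _ i.2, cfDig_of_lt _ i.2] at e2
    exact e2
  rw [hww]

/-- **Tiling inequality (disjointness):** summing a nonnegative function over the fibres of the
section gives at most the sum over all of `Aᴺ`. [folklore] -/
theorem sum_cfSec_fibre_le (X : ℝ) (N : ℕ) {f : (Fin N → A) → ℝ} (hf : ∀ v, 0 ≤ f v) :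
    ∑ x ∈ cfSec A X N, ∑ u : Fin (N - x.1) → A, f (cfIns N x.2 u) ≤ ∑ v : Fin N → A, f v := by
  have h1 : ∀ x ∈ cfSec A X N, ∑ u : Fin (N - x.1) → A, f (cfIns N x.2 u) =
      ∑ v ∈ (Finset.univ : Finset (Fin (N - x.1) → A)).image (cfIns N x.2), f v := fun x _ => by
    rw [Finset.sum_image fun u _ u' _ h => cfIns_injective x.2 h]
  rw [Finset.sum_congr rfl h1, ← Finset.sum_biUnion (cfSec_pairwiseDisjoint X N)]
  exact Finset.sum_le_sum_of_subset_of_nonneg (Finset.subset_univ _) fun v _ _ => hf v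

/-- **Tiling inequality (covering):** if every word of `Aᴺ` stops at some `n ≤ N`, the sum over
all of `Aᴺ` is at most the sum over the fibres of the section. [folklore] -/
theorem sum_le_sum_cfSec_fibre {X : ℝ} {N : ℕ} (hcov : ∀ v : Fin N → A, ∃ n, n ≤ N ∧ cfStop X v n)
    {f : (Fin N → A) → ℝ} (hf : ∀ v, 0 ≤ f v) :
    ∑ v : Fin N → A, f v ≤ ∑ x ∈ cfSec A X N, ∑ u : Fin (N - x.1) → A, f (cfIns N x.2 u) := by
  have h1 : ∀ x ∈ cfSec A X N, ∑ u : Fin (N - x.1) → A, f (cfIns N x.2 u) =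
      ∑ v ∈ (Finset.univ : Finset (Fin (N - x.1) → A)).image (cfIns N x.2), f v := fun x _ => by
    rw [Finset.sum_image fun u _ u' _ h => cfIns_injective x.2 h]
  rw [Finset.sum_congr rfl h1, ← Finset.sum_biUnion (cfSec_pairwiseDisjoint X N)]
  refine Finset.sum_le_sum_of_subset_of_nonneg (fun v _ => ?_) fun v _ _ => hf v
  obtain ⟨n, hn, hstop⟩ := hcov v
  rw [Finset.mem_biUnion]
  refine ⟨⟨n, cfRestr hn v⟩, mem_cfSec.2 ⟨hn, ?_⟩, ?_⟩
  · exact (cfStop_iff_of_agree fun i hi => (cfDig_cfRestr hn v hi).symm).1 hstop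
  · exact Finset.mem_image.2 ⟨cfTail n v, Finset.mem_univ _, cfIns_cfRestr_cfTail hn v⟩

/-- The weight of a word: `(q(v)²)^{-s}`, the summand of `Z_N(s)`. [folklore] -/
theorem cfPartition_eq_sum_cfQk (N : ℕ) (s : ℝ) :
    cfPartition A N s = ∑ v : Fin N → A, (((cfQk v N : ℝ)) ^ 2) ^ (-s) := rfl

section SectionSize

variable (hA : ∀ a ∈ A, 1 ≤ a)
include hA

/-- **Fibre sums, lower:** `Σ_u (q(wu)²)^{-s} ≥ 4^{-s} (q(w)²)^{-s} Z_{N-n}(s)` (`s ≥ 0`). [folklore] -/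
theorem le_fibre_sum {s : ℝ} (hs : 0 ≤ s) (hn : n ≤ N) (w : Fin n → A) :
    (4 : ℝ) ^ (-s) * ((((cfQk w n : ℝ)) ^ 2) ^ (-s) * cfPartition A (N - n) s) ≤
      ∑ u : Fin (N - n) → A, (((cfQk (cfIns N w u) N : ℝ)) ^ 2) ^ (-s) := by
  rw [cfPartition_eq_sum_cfQk, Finset.mul_sum, Finset.mul_sum]
  refine Finset.sum_le_sum fun u _ => ?_
  have hw1 : (1 : ℝ) ≤ (cfQk w n : ℝ) := by exact_mod_cast one_le_cfQk hA w n
  have hu1 : (1 : ℝ) ≤ (cfQk u (N - n) : ℝ) := by exact_mod_cast one_le_cfQk hA u (N - n)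
  have hv1 : (1 : ℝ) ≤ (cfQk (cfIns N w u) N : ℝ) := by exact_mod_cast one_le_cfQk hA _ N
  have hup : (cfQk (cfIns N w u) N : ℝ) ≤ 2 * ((cfQk w n : ℝ) * cfQk u (N - n)) := by
    exact_mod_cast (cfQk_cfIns_bounds hA hn w u).2
  rw [← Real.mul_rpow (by positivity) (by positivity), ← Real.mul_rpow (by norm_num) (by positivity)]
  refine Real.rpow_le_rpow_of_nonpos (by positivity) ?_ (by linarith)
  nlinarith

/-- **Fibre sums, upper:** `Σ_u (q(wu)²)^{-s} ≤ (q(w)²)^{-s} Z_{N-n}(s)` (`s ≥ 0`). [folklore] -/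
theorem fibre_sum_le {s : ℝ} (hs : 0 ≤ s) (hn : n ≤ N) (w : Fin n → A) :
    ∑ u : Fin (N - n) → A, (((cfQk (cfIns N w u) N : ℝ)) ^ 2) ^ (-s) ≤
      ((((cfQk w n : ℝ)) ^ 2) ^ (-s)) * cfPartition A (N - n) s := by
  rw [cfPartition_eq_sum_cfQk, Finset.mul_sum]
  refine Finset.sum_le_sum fun u _ => ?_
  have hw1 : (1 : ℝ) ≤ (cfQk w n : ℝ) := by exact_mod_cast one_le_cfQk hA w n
  have hu1 : (1 : ℝ) ≤ (cfQk u (N - n) : ℝ) := by exact_mod_cast one_le_cfQk hA u (N - n)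
  have hlow : (cfQk w n : ℝ) * cfQk u (N - n) ≤ cfQk (cfIns N w u) N := by
    exact_mod_cast (cfQk_cfIns_bounds hA hn w u).1
  rw [← Real.mul_rpow (by positivity) (by positivity), ← mul_pow]
  exact Real.rpow_le_rpow_of_nonpos (by positivity) (pow_le_pow_left₀ (by positivity) hlow 2)
    (by linarith)

/-- **Size of the section, upper bound:** if `Z_m(s) ≥ 1` for all `m` and `Z_N(s) ≤ 4^s`, then
`#S_X^{≤ N} ≤ 16^s ((B+1)X)^{2s}` for `X ≥ 1`, `A ⊆ [1, B]`. [folklore] -/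
theorem card_cfSec_le (hne : A.Nonempty) {B : ℕ} (hB : ∀ a ∈ A, a ≤ B) {s : ℝ} (hs : 0 ≤ s)
    (hZ1 : ∀ m, 1 ≤ cfPartition A m s) {N : ℕ} (hZ4 : cfPartition A N s ≤ (4 : ℝ) ^ s)
    {X : ℝ} (hX : 1 ≤ X) :
    ((cfSec A X N).card : ℝ) ≤ (16 : ℝ) ^ s * ((((B : ℝ) + 1) * X) ^ 2) ^ s := by
  -- each fibre has weight ≥ 4^{-s} (((B+1)X)²)^{-s}
  set c : ℝ := (4 : ℝ) ^ (-s) * ((((B : ℝ) + 1) * X) ^ 2) ^ (-s) with hc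
  have hBX : 0 < ((B : ℝ) + 1) * X := by positivity
  have hfib : ∀ x ∈ cfSec A X N,
      c ≤ ∑ u : Fin (N - x.1) → A, (((cfQk (cfIns N x.2 u) N : ℝ)) ^ 2) ^ (-s) := by
    intro x hx
    rw [mem_cfSec] at hx
    refine le_trans ?_ (le_fibre_sum hA hs hx.1 x.2)
    rw [hc]
    refine mul_le_mul_of_nonneg_left ?_ (Real.rpow_nonneg (by norm_num) _)
    have hq1 : (1 : ℝ) ≤ (cfQk x.2 x.1 : ℝ) := by exact_mod_cast one_le_cfQk hA x.2 x.1
    have hqle : (cfQk x.2 x.1 : ℝ) ≤ ((B : ℝ) + 1) * X := cfQk_le_of_cfStop hA hB hne hX hx.2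
    calc ((((B : ℝ) + 1) * X) ^ 2) ^ (-s) ≤ (((cfQk x.2 x.1 : ℝ)) ^ 2) ^ (-s) :=
          Real.rpow_le_rpow_of_nonpos (by positivity) (pow_le_pow_left₀ (by positivity) hqle 2)
            (by linarith)
      _ = (((cfQk x.2 x.1 : ℝ)) ^ 2) ^ (-s) * 1 := (mul_one _).symm
      _ ≤ (((cfQk x.2 x.1 : ℝ)) ^ 2) ^ (-s) * cfPartition A (N - x.1) s :=
          mul_le_mul_of_nonneg_left (hZ1 _) (Real.rpow_nonneg (by positivity) _)
  have hsum : ((cfSec A X N).card : ℝ) * c ≤ cfPartition A N s := by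
    calc ((cfSec A X N).card : ℝ) * c = ∑ x ∈ cfSec A X N, c := by
          rw [Finset.sum_const, nsmul_eq_mul]
      _ ≤ ∑ x ∈ cfSec A X N, ∑ u : Fin (N - x.1) → A,
            (((cfQk (cfIns N x.2 u) N : ℝ)) ^ 2) ^ (-s) := Finset.sum_le_sum hfib
      _ ≤ ∑ v : Fin N → A, (((cfQk v N : ℝ)) ^ 2) ^ (-s) :=
          sum_cfSec_fibre_le X N (f := fun v => (((cfQk v N : ℝ)) ^ 2) ^ (-s))
            fun v => Real.rpow_nonneg (by positivity) _
      _ = cfPartition A N s := (cfPartition_eq_sum_cfQk N s).symm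
  have hcpos : 0 < c := by rw [hc]; positivity
  have hcinv : c⁻¹ = (4 : ℝ) ^ s * ((((B : ℝ) + 1) * X) ^ 2) ^ s := by
    rw [hc, mul_inv, Real.rpow_neg (x := 4) (by norm_num),
      Real.rpow_neg (x := (((B : ℝ) + 1) * X) ^ 2) (by positivity), inv_inv, inv_inv]
  have h16 : (16 : ℝ) ^ s = (4 : ℝ) ^ s * (4 : ℝ) ^ s := by
    rw [← Real.mul_rpow (by norm_num) (by norm_num)]; norm_num
  calc ((cfSec A X N).card : ℝ) ≤ cfPartition A N s / c := by
        rw [le_div_iff₀ hcpos]; exact hsum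
    _ ≤ (4 : ℝ) ^ s / c := div_le_div_of_nonneg_right hZ4 hcpos.le
    _ = (16 : ℝ) ^ s * ((((B : ℝ) + 1) * X) ^ 2) ^ s := by
        rw [div_eq_mul_inv, hcinv, h16, mul_assoc]

/-- **Size of the section, lower bound:** if `1 ≤ Z_N(s)`, `Z_m(s) ≤ 4^s` for all `m`, and `N`
is so large that every word of `Aᴺ` stops (`2^{N-1} > X²`), then `4^{-s} (X²)^s ≤ #S_X^{≤N}`
(`X ≥ 0`). [folklore] -/
theorem le_card_cfSec {s : ℝ} (hs : 0 ≤ s) (hZ4 : ∀ m, cfPartition A m s ≤ (4 : ℝ) ^ s) {N : ℕ}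
    (hZ1 : 1 ≤ cfPartition A N s) {X : ℝ} (hX0 : 0 < X) (hN : X ^ 2 < (2 : ℝ) ^ (N - 1)) :
    (4 : ℝ) ^ (-s) * (X ^ 2) ^ s ≤ ((cfSec A X N).card : ℝ) := by
  have hcov := exists_cfStop_of_pow hA hX0.le hN
  -- each fibre has weight ≤ 4^s (X²)^{-s}
  set c : ℝ := (4 : ℝ) ^ s * (X ^ 2) ^ (-s) with hc
  have hfib : ∀ x ∈ cfSec A X N,
      ∑ u : Fin (N - x.1) → A, (((cfQk (cfIns N x.2 u) N : ℝ)) ^ 2) ^ (-s) ≤ c := by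
    intro x hx
    rw [mem_cfSec] at hx
    refine (fibre_sum_le hA hs hx.1 x.2).trans ?_
    rw [hc, mul_comm]
    have hXq : X < (cfQk x.2 x.1 : ℝ) := hx.2.1
    refine mul_le_mul (hZ4 _) ?_ (Real.rpow_nonneg (by positivity) _) (by positivity)
    exact Real.rpow_le_rpow_of_nonpos (by positivity) (pow_le_pow_left₀ hX0.le hXq.le 2)
      (by linarith)
  have hsum : cfPartition A N s ≤ ((cfSec A X N).card : ℝ) * c := by
    calc cfPartition A N s = ∑ v : Fin N → A, (((cfQk v N : ℝ)) ^ 2) ^ (-s) :=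
          cfPartition_eq_sum_cfQk N s
      _ ≤ ∑ x ∈ cfSec A X N, ∑ u : Fin (N - x.1) → A,
            (((cfQk (cfIns N x.2 u) N : ℝ)) ^ 2) ^ (-s) :=
          sum_le_sum_cfSec_fibre hcov (f := fun v => (((cfQk v N : ℝ)) ^ 2) ^ (-s))
            fun v => Real.rpow_nonneg (by positivity) _
      _ ≤ ∑ x ∈ cfSec A X N, c := Finset.sum_le_sum hfib
      _ = ((cfSec A X N).card : ℝ) * c := by rw [Finset.sum_const, nsmul_eq_mul]
  have hcpos : 0 < c := by rw [hc]; positivity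
  have hcinv : c⁻¹ = (4 : ℝ) ^ (-s) * (X ^ 2) ^ s := by
    rw [hc, mul_inv, Real.rpow_neg (x := 4) (by norm_num), Real.rpow_neg (x := X ^ 2) (by positivity),
      inv_inv]
  calc (4 : ℝ) ^ (-s) * (X ^ 2) ^ s = 1 * c⁻¹ := by rw [hcinv, one_mul]
    _ ≤ cfPartition A N s * c⁻¹ := mul_le_mul_of_nonneg_right hZ1 (by positivity)
    _ ≤ ((cfSec A X N).card : ℝ) := by
        rw [← div_eq_mul_inv, div_le_iff₀ hcpos]; exact hsum

end SectionSize

end Literature.NumberTheory.Sieve
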